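import Summits.RiemannHypothesis.RiemannHypothesis.Theorems.Splittings.LiIncrHighPart
import HarnessLib

/-!
# THE NO-DRIFT (FIRST-MOMENT) LAW of the low phase sum — PURE / RH-FREE, any ordinates (SketchG15 §5)

PRE-CUT (not filed): cell rh-split, seat rh-split-li-bridge g15 (brief sha16 f79c5f09d8bcb036), card
`run/shared/lean/pub/rh-split/cards/SPLIT-li-bridge.md` §22 (P5); kernel source `HOME/rh-split-li-bridge/SketchG15.lean`
sha16 ba4fe6528513c7ef (FROZEN, RULING #160), §5, decl text byte-verbatim; deltas = namespace `RhSplit.LiBridgeG15` ↦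
`…Theorems.Splittings.LiLowSumNoDrift`, imports trimmed to `LiIncrHighPart`, this header, `set_option linter.dupNamespace false`.
Companion of `LiLowPhaseLaw` (§§1–4, 6).  Zero definitions.

`lowSum n Y = Σ_{ρ ∈ zerosBetween 0 Y} m_ρ · 4 sin(θ_γ/2) · sin((n+½)θ_γ)` (tree `LiIncrHighPartSplit`), `θ = liZeroAngle`,
`w_n(γ) = liWindowWeight n γ = 1 − cos nθ_γ`.  Content: the LEVEL FORM `lowSum n Y = Σ m_ρ · 2(w_{n+1}(γ) − w_n(γ))`, its
telescoping over blocks of consecutive `n`, and the FIRST-MOMENT LAW `|Σ_{i<M} lowSum (N+i) Y| ≤ 4 Σ_{0<γ≤Y} m_ρ` (also on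
`Finset.Ico N N'`): block averages of the low sum are `O(N(Y)/M)` WHATEVER THE ORDINATES ARE — eventual monotonicity of
`λ_n` is decided by pointwise phase alignment, never by drift (card §22.2).

HONEST LABEL: SPLITTING SEARCH over kernel-typed RH-EQUIVALENCES; a splitting A ∧ B ⟹ RH is CONDITIONAL bookkeeping
unless A and B are both proved; nothing here bears on the truth of RH.  Every theorem below is PURE / RH-FREE.
-/

set_option linter.dupNamespace false

namespace Summit.RiemannHypothesis.RiemannHypothesis.Theorems.Splittings.LiLowSumNoDrift

open Filter Topology Finset
open scoped Real
open Literature.NumberTheory.LFunctions Literature.NumberTheory.LFunctions.SchoenfeldBound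
open Summit.RiemannHypothesis.RiemannHypothesis.Theorems.LiTheory
open Summit.RiemannHypothesis.RiemannHypothesis.Theorems.Splittings
open Summit.RiemannHypothesis.RiemannHypothesis.Theorems.Splittings.LiIncrHighPart

/-! ## §5 The level form and the first-moment (no-drift) law of the low sum — PURE / RH-FREE -/

/-- Level form of the low sum: `4 sin(θ/2) sin((n+½)θ) = 2(f_{n+1} − f_n)`, `f_n(t) = liWindowWeight n t = 1 − cos(nθ_t)`
(the tree's `incrWeight_eq`). RH-FREE (an identity). -/
theorem lowSum_eq_sum_windowWeight_sub (n : ℕ) (Y : ℝ) :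
    lowSum n Y = ∑ ρ ∈ zerosBetween 0 Y,
      mult ρ * (2 * (liWindowWeight (n + 1) ρ.im - liWindowWeight n ρ.im)) := by
  unfold lowSum
  refine Finset.sum_congr rfl fun ρ _ ↦ ?_
  have h := incrWeight_eq n ρ.im
  unfold incrWeight at h
  rw [mul_assoc, ← h]

/-- Block sums of the low sum TELESCOPE: `Σ_{i<M} lowSum (N+i) Y = Σ_ρ m_ρ · 2(f_{N+M}(γ) − f_N(γ))`. RH-FREE. -/
theorem sum_range_lowSum_eq (N M : ℕ) (Y : ℝ) :
    ∑ i ∈ Finset.range M, lowSum (N + i) Y =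
      ∑ ρ ∈ zerosBetween 0 Y, mult ρ * (2 * (liWindowWeight (N + M) ρ.im - liWindowWeight N ρ.im)) := by
  induction M with
  | zero => simp
  | succ M ih =>
    rw [Finset.sum_range_succ, ih, lowSum_eq_sum_windowWeight_sub, ← Finset.sum_add_distrib]
    refine Finset.sum_congr rfl fun ρ _ ↦ ?_
    rw [show N + (M + 1) = N + M + 1 from (Nat.add_assoc _ _ _).symm]
    ring

/-- **FIRST-MOMENT (NO-DRIFT) LAW of the low sum**: `|Σ_{i<M} lowSum (N+i) Y| ≤ 4 Σ_{0<γ≤Y} m_ρ` for all `N, M, Y`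
(`0 ≤ f_n ≤ 2`, `m_ρ ≥ 0`).  Block averages of the low phase sum are `O(N(Y)/M)` whatever the ordinates are: the low
sum has no drift, and a failure of `PL` can only come from POINTWISE alignment of the phases `(n+½)θ_γ`. RH-FREE. -/
theorem abs_sum_range_lowSum_le (N M : ℕ) (Y : ℝ) :
    |∑ i ∈ Finset.range M, lowSum (N + i) Y| ≤ 4 * ∑ ρ ∈ zerosBetween 0 Y, mult ρ := by
  rw [sum_range_lowSum_eq, Finset.mul_sum]
  refine (Finset.abs_sum_le_sum_abs _ _).trans (Finset.sum_le_sum fun ρ hρ ↦ ?_)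
  have hm : 0 ≤ mult ρ := zeroOrder_nonneg_of_mem_zerosBetween le_rfl hρ
  have hf1 : 0 ≤ liWindowWeight (N + M) ρ.im ∧ liWindowWeight (N + M) ρ.im ≤ 2 := by
    unfold liWindowWeight
    exact ⟨by linarith [Real.cos_le_one (((N + M : ℕ) : ℝ) * liZeroAngle ρ.im)],
      by linarith [Real.neg_one_le_cos (((N + M : ℕ) : ℝ) * liZeroAngle ρ.im)]⟩
  have hf2 : 0 ≤ liWindowWeight N ρ.im ∧ liWindowWeight N ρ.im ≤ 2 := by
    unfold liWindowWeight
    exact ⟨by linarith [Real.cos_le_one ((N : ℝ) * liZeroAngle ρ.im)],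
      by linarith [Real.neg_one_le_cos ((N : ℝ) * liZeroAngle ρ.im)]⟩
  have h4 : |2 * (liWindowWeight (N + M) ρ.im - liWindowWeight N ρ.im)| ≤ 4 := by
    rw [abs_le]; constructor <;> linarith [hf1.1, hf1.2, hf2.1, hf2.2]
  rw [abs_mul, abs_of_nonneg hm]
  calc mult ρ * |2 * (liWindowWeight (N + M) ρ.im - liWindowWeight N ρ.im)| ≤ mult ρ * 4 :=
        mul_le_mul_of_nonneg_left h4 hm
    _ = 4 * mult ρ := mul_comm _ _

/-- The same for an arbitrary block `[N, N')`: `|Σ_{N ≤ n < N'} lowSum n Y| ≤ 4 Σ_{0<γ≤Y} m_ρ`. RH-FREE. -/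
theorem abs_sum_Ico_lowSum_le {N N' : ℕ} (hNN : N ≤ N') (Y : ℝ) :
    |∑ n ∈ Finset.Ico N N', lowSum n Y| ≤ 4 * ∑ ρ ∈ zerosBetween 0 Y, mult ρ := by
  rw [Finset.sum_Ico_eq_sum_range]
  obtain ⟨M, rfl⟩ := Nat.exists_eq_add_of_le hNN
  rw [Nat.add_sub_cancel_left]
  exact abs_sum_range_lowSum_le N M Y

end Summit.RiemannHypothesis.RiemannHypothesis.Theorems.Splittings.LiLowSumNoDrift
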